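import Literature.NumberTheory.EllipticCurves.Gamma0CocycleDegeneracyMaps
import HarnessLib

/-!
# Relative Ihara at a prime dividing the level — the ELEMENTARY layer of E-es-25 (MEMO-es §21.2), kernel-checked

Summit `BirchSwinnertonDyer`, crux C3 `ManinPrimeToThreeAtNine` (stmt-BirchSwinnertonDyer-22968) and deciding crux C2
`ManinOddAtFour` (stmt-BirchSwinnertonDyer-22967) of route `ManinLocalTwoThree` (cell bsd-f2-manin).  The only
conjectural Euler-system inputs of both active skeleton lines (`stub_shiftClass_generation` = E-es-19 on C3,
`stub_multiShiftClass_generation` = E-es-22 on C2) are consequences of ONE f-free cohomological statement E-es-25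
(«relative Ihara at a prime `t` dividing the level», planner bsd-f2-manin-es g9, MEMO-es §21.1–21.3; the seat's p3 has
landed the reductions to shift-invariant functional cocycles, `Theorems/ManinLocalTwoThreeGenerationCocycle.lean`).  Its
proof sketch §21.2 has five steps; this file kernel-checks the two ELEMENTARY ones, in the vocabulary of the typer's
`Literature/NumberTheory/EllipticCurves/Gamma0CocycleDegeneracyMaps.lean` (T-es-12: `Gamma0.degeneracyConj`,
`HidaCohomology.degeneracyPullback`):

* §21.2 (2) **generation one level down** — `range_degeneracyConj_one_sup_range_degeneracyConj_eq_top`: for a prime `t` and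
  levels `M ∣ L ∣ M t`, `M t ∣ L` (i.e. `L = M t`), the subgroup of `Γ₀(M)` generated by `Γ₀(L)` (= the range of the
  degeneracy conjugation by `diag(1,1)`) and `diag(t,1) Γ₀(L) diag(t,1)⁻¹` (= the range of `Gamma0.degeneracyConj M L t`)
  is all of `Γ₀(M)`; with `mem_range_degeneracyConj_iff_dvd`: the second range is `Γ₀(M) ∩ Γ⁰(t)` (upper-right entry
  divisible by `t`).  Proof: for `γ = (a b; c d) ∈ Γ₀(M)` pick `x ∈ {0, 1}` with `t ∤ a + x c` (`t` prime, `gcd(a,c)=1`),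
  then `u` with `t ∣ (a + x c) u + (b + x d)` (Bézout); `(1 x; 0 1) γ (1 u; 0 1) ∈ Γ₀(M) ∩ Γ⁰(t)` and the unipotents lie
  in `Γ₀(L)`.
* §21.2 (4) **the shift-from-pairs recursion** — `eq_zero_of_shiftInvariant_of_pairs_of_bottom`: for ANY family
  `V L ⊆ (Γ₀(L) → R)` of degree-`0` cochains stable under the pull-backs `π_d^*`, IF (Pairs, = E-es-25 pairs form at
  `t ∣ L`) every pair `(φ₁, φ₂) ∈ V(L)²`, `L = M t`, with `π_t^* φ₁ = π_1^* φ₂` on `Γ₀(L t)` comes from some `ψ ∈ V(M)`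
  (`φ₁ = π_1^* ψ`, `φ₂ = π_t^* ψ`), and (Bottom, = the classical diagonal Ihara statement at `t ∤ L₀`) every such pair at a
  level prime to `t` has `φ₂ = 0`, THEN for every `n ≥ 1` and every level `L ≥ 1`, every `φ ∈ V(L)` with
  `π_{t^n}^* φ = π_1^* φ` on `Γ₀(L t^n)` vanishes (`Z_n(L) = 0`).  The planner wrote the case `n = 3`, `t = 2` by hand
  (NOTES ## THEORY g9); here it is an induction on the level with the chain `ψ_1, …, ψ_{n-1}` of §21.2 (4) as an inner
  induction (`exists_descent_of_shiftInvariant`).  Levels are free variables pinned by two-sided divisibility (never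
  computed products), so the user's `3 * N` and the typer's `N * 3` both instantiate.

What is NOT here (the non-elementary inputs of §21.2, unchanged): (1) the non-Eisenstein descent (Hochschild–Serre with
Hecke-equivariant edge terms), which is what PRODUCES the hypothesis (Pairs); (5) the bottom case at `t ∤ L₀`
(hypothesis (Bottom)) = Khare-type glue + the congruence subgroup property of `SL₂(ℤ[1/t])` — the latter is a TREE
THEOREM (`Literature.NumberTheory.Automorphic.SerreSL2Congruence1970_congruenceSubgroupProperty_away_holds`) — + the
Eisenstein census of congruence characters.  Nothing about BSD or Manin's conjecture is proved by this file; it bears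
on 22968/22967 only through E-es-25 ⟹ E-es-19 ∧ E-es-22.

References: MEMO-es §21 (cell bsd-f2-manin, HOME/MEMO-es.md); [DarmonDiamondTaylor1995] Lemma 4.28 and Remark 4.29
(Khare's method); C. Khare, Duke Math. J. 80 (1995) (the `(p,p)` case of Ihara's lemma — not held, acq-09663).
-/

set_option autoImplicit false
set_option linter.dupNamespace false

open scoped MatrixGroups

open CongruenceSubgroup Literature.NumberTheory.EllipticCurves.ModularForms
  Literature.NumberTheory.EllipticCurves.ModularForms.HidaCohomology

namespace Summit.BirchSwinnertonDyer.BirchSwinnertonDyer.Theorems.ManinLocalTwoThree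

/-! ### §21.2 (2): `Γ₀(L)` and `diag(t,1) Γ₀(L) diag(t,1)⁻¹` generate `Γ₀(M)` (`L = M t`, `t` prime) -/

section Generation

variable {M L t : ℕ} [NeZero t]

/-- **The range of the degeneracy conjugation is `Γ₀(M) ∩ Γ⁰(t)`**: for `M t ∣ L ∣ M t` (`L = M t`), an element
`γ = (a b; c d) ∈ Γ₀(M)` is `diag(t,1) δ diag(t,1)⁻¹` for some `δ ∈ Γ₀(L)` iff `t ∣ b` (then `δ = (a, b/t; t c, d)`).
[folklore] -/
theorem mem_range_degeneracyConj_iff_dvd (ht : M * t ∣ L) (hL : L ∣ M * t) (γ : Gamma0 M) :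
    γ ∈ (Gamma0.degeneracyConj M L t ht).range ↔ (t : ℤ) ∣ (γ : SL(2, ℤ)) 0 1 := by
  constructor
  · rintro ⟨δ, rfl⟩
    exact ⟨(δ : SL(2, ℤ)) 0 1, by simp [Gamma0.degeneracyConjElt]⟩
  · rintro ⟨b', hb'⟩
    have hγM : (M : ℤ) ∣ (γ : SL(2, ℤ)) 1 0 := by
      have h := γ.2
      rw [Gamma0_mem] at h
      exact (ZMod.intCast_zmod_eq_zero_iff_dvd _ M).mp h
    have hdet := Matrix.det_fin_two (γ : SL(2, ℤ)).1
    rw [(γ : SL(2, ℤ)).2] at hdet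
    -- the lift `δ = (a, b/t; t c, d) ∈ Γ₀(L)`
    let A : SL(2, ℤ) := ⟨!![(γ : SL(2, ℤ)) 0 0, b'; (t : ℤ) * (γ : SL(2, ℤ)) 1 0, (γ : SL(2, ℤ)) 1 1], by
      rw [Matrix.det_fin_two_of]
      linear_combination -hdet + ((γ : SL(2, ℤ)) 1 0) * hb'⟩
    have hA : A ∈ Gamma0 L := by
      rw [Gamma0_mem]
      change (((t : ℤ) * (γ : SL(2, ℤ)) 1 0 : ℤ) : ZMod L) = 0
      refine (ZMod.intCast_zmod_eq_zero_iff_dvd _ L).mpr ?_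
      have h1 : (L : ℤ) ∣ (M : ℤ) * t := by exact_mod_cast hL
      refine h1.trans ?_
      rw [mul_comm (M : ℤ)]
      exact mul_dvd_mul_left (t : ℤ) hγM
    refine ⟨⟨A, hA⟩, ?_⟩
    have ht0 : (t : ℤ) ≠ 0 := by exact_mod_cast NeZero.ne t
    apply Subtype.ext
    ext i j
    fin_cases i <;> fin_cases j
    · simp [Gamma0.degeneracyConjElt, A]
    · simp [Gamma0.degeneracyConjElt, A, hb']
    · simp [Gamma0.degeneracyConjElt, A, Int.mul_ediv_cancel_left _ ht0]
    · simp [Gamma0.degeneracyConjElt, A]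

/-- A matrix of `SL₂(ℤ)` with lower-left entry `0` (e.g. the upper unipotent `(1 x; 0 1)`) lies in every `Γ₀(N)`
(plumbing). [folklore] -/
theorem mem_Gamma0_of_apply_one_zero_eq_zero (N : ℕ) (A : SL(2, ℤ)) (hA : A 1 0 = 0) : A ∈ Gamma0 N := by
  rw [Gamma0_mem, hA, Int.cast_zero]

/-- **Generation one level down** (MEMO-es §21.2 (2); the adelic «`K₀(t^k)` and its `diag(t,1)`-conjugate generate
`K₀(t^{k-1})`», Wiles's Lemma 2.5 mechanism for `Γ₀`): for a prime `t` and `L = M t` (as `M t ∣ L ∣ M t`), the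
subgroups `Γ₀(L) ≤ Γ₀(M)` (range of the degeneracy conjugation by `diag(1,1)`) and
`diag(t,1) Γ₀(L) diag(t,1)⁻¹ = Γ₀(M) ∩ Γ⁰(t)` (range of `Gamma0.degeneracyConj M L t`) generate `Γ₀(M)`.
Proof: for `γ = (a b; c d)`, some `x ∈ {0,1}` has `t ∤ a + x c` (`t` prime, `a d − b c = 1`); Bézout gives `u` with
`t ∣ (a + x c) u + (b + x d)`; then `(1 x; 0 1) γ (1 u; 0 1)` has upper-right entry divisible by `t`, and the two
unipotents lie in `Γ₀(L)`. [folklore] -/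
theorem range_degeneracyConj_one_sup_range_degeneracyConj_eq_top (htp : t.Prime) (h₁ : M * 1 ∣ L) (ht : M * t ∣ L)
    (hL : L ∣ M * t) :
    (Gamma0.degeneracyConj M L 1 h₁).range ⊔ (Gamma0.degeneracyConj M L t ht).range = ⊤ := by
  rw [eq_top_iff]
  intro γ _
  set S : Subgroup (Gamma0 M) := (Gamma0.degeneracyConj M L 1 h₁).range ⊔ (Gamma0.degeneracyConj M L t ht).range
    with hS
  -- the unipotents `T x = (1 x; 0 1) ∈ Γ₀(M)` lie in `S` (they come from `Γ₀(L)`)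
  let Tm : ℤ → SL(2, ℤ) := fun x ↦ ⟨!![1, x; 0, 1], by rw [Matrix.det_fin_two_of]; ring⟩
  let T : ℤ → Gamma0 M := fun x ↦ ⟨Tm x, mem_Gamma0_of_apply_one_zero_eq_zero M (Tm x) rfl⟩
  have hT : ∀ x, T x ∈ S := by
    intro x
    refine Subgroup.mem_sup_left ⟨⟨Tm x, mem_Gamma0_of_apply_one_zero_eq_zero L (Tm x) rfl⟩, ?_⟩
    apply Subtype.ext
    rw [Gamma0.coe_degeneracyConj_one]
  -- entries
  set a : ℤ := (γ : SL(2, ℤ)) 0 0 with ha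
  set b : ℤ := (γ : SL(2, ℤ)) 0 1 with hb
  set c : ℤ := (γ : SL(2, ℤ)) 1 0 with hc
  set d : ℤ := (γ : SL(2, ℤ)) 1 1 with hd
  have hdet : a * d - b * c = 1 := by
    have h := Matrix.det_fin_two (γ : SL(2, ℤ)).1
    rw [(γ : SL(2, ℤ)).2] at h
    rw [ha, hb, hc, hd]; linarith
  -- Step 1: `x ∈ {0, 1}` with `t ∤ a + x c`
  obtain ⟨x, hx⟩ : ∃ x : ℤ, ¬ (t : ℤ) ∣ a + x * c := by
    by_cases hta : (t : ℤ) ∣ a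
    · refine ⟨1, fun h ↦ ?_⟩
      have htc : (t : ℤ) ∣ c := by simpa using (dvd_sub h hta)
      have : (t : ℤ) ∣ 1 := by
        rw [← hdet]
        exact dvd_sub (hta.mul_right d) (htc.mul_left b)
      exact htp.one_lt.ne' (by exact_mod_cast Int.eq_one_of_dvd_one (by positivity) this)
    · exact ⟨0, by simpa using hta⟩
  -- Step 2: Bézout — `u` with `t ∣ (a + x c) u + (b + x d)`
  obtain ⟨u, hu⟩ : ∃ u : ℤ, (t : ℤ) ∣ (a + x * c) * u + (b + x * d) := by
    have hcop : IsCoprime (t : ℤ) (a + x * c) :=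
      (Prime.coprime_iff_not_dvd (Nat.prime_iff_prime_int.mp htp)).mpr hx
    obtain ⟨q, p, hpq⟩ := hcop
    refine ⟨-(b + x * d) * p, ⟨(b + x * d) * q, ?_⟩⟩
    linear_combination (-(b + x * d)) * hpq
  -- Step 3: `γ₂ := T x * γ * T u ∈ Γ₀(M) ∩ Γ⁰(t)`
  have hγ₂ : T x * γ * T u ∈ S := by
    refine Subgroup.mem_sup_right ((mem_range_degeneracyConj_iff_dvd ht hL _).mpr ?_)
    have : ((T x * γ * T u : Gamma0 M) : SL(2, ℤ)) 0 1 = (a + x * c) * u + (b + x * d) := by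
      simp only [Subgroup.coe_mul, Matrix.SpecialLinearGroup.coe_mul, T, Tm, ha, hb, hc, hd]
      rw [Matrix.mul_apply, Fin.sum_univ_two, Matrix.mul_apply, Matrix.mul_apply, Fin.sum_univ_two,
        Fin.sum_univ_two]
      simp
    rw [this]
    exact hu
  have key : γ = (T x)⁻¹ * (T x * γ * T u) * (T u)⁻¹ := by group
  rw [key]
  exact S.mul_mem (S.mul_mem (S.inv_mem (hT x)) hγ₂) (S.inv_mem (hT u))

end Generation


/-! ### Plumbing for the pull-backs `π_d^*` (level and shift transport) -/

section Plumbing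

variable {k M L : ℕ} {R : Type*} [CommRing R]

/-- `π_1^*` from a level to itself is the identity (plumbing). [folklore] -/
theorem degeneracyPullback_one_self (h : L * 1 ∣ L) (u : Gamma0 L → Fin (k + 1) → R) :
    degeneracyPullback k L L 1 R h u = u := by
  funext γ
  rw [degeneracyPullback_one_apply]
  congr 1
  exact Subtype.ext (Gamma0.coe_degeneracyConj_one h γ)

/-- `π_1^* ∘ π_1^* = π_1^*` (plumbing). [folklore] -/
theorem degeneracyPullback_one_one {L₁ : ℕ} (h₁ : L₁ * 1 ∣ L) (h₂ : M * 1 ∣ L₁) (h : M * 1 ∣ L)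
    (u : Gamma0 M → Fin (k + 1) → R) :
    degeneracyPullback k L₁ L 1 R h₁ (degeneracyPullback k M L₁ 1 R h₂ u) = degeneracyPullback k M L 1 R h u := by
  rw [degeneracyPullback_degeneracyPullback h₁ h₂ (by simpa using h) u]

/-- `π_{d₁}^* ∘ π_{d₂}^* = π_{d}^*` whenever `d = d₂ d₁` (composition with the shift transported; plumbing). [folklore] -/
theorem degeneracyPullback_comp {L₁ d₁ d₂ d : ℕ} [NeZero d₁] [NeZero d₂] [NeZero d] (e : d₂ * d₁ = d)
    (h₁ : L₁ * d₁ ∣ L) (h₂ : M * d₂ ∣ L₁) (h : M * d ∣ L) (u : Gamma0 M → Fin (k + 1) → R) :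
    degeneracyPullback k L₁ L d₁ R h₁ (degeneracyPullback k M L₁ d₂ R h₂ u) = degeneracyPullback k M L d R h u := by
  subst e
  exact degeneracyPullback_degeneracyPullback h₁ h₂ h u

end Plumbing

/-! ### §21.2 (4): the shift-from-pairs recursion, abstract over the family `V` -/

section Recursion

variable {R : Type*} [CommRing R] (V : (L : ℕ) → Set (Gamma0 L → Fin 1 → R)) (t : ℕ) [NeZero t]

/-- **The descent chain `ψ_1, …, ψ_j` of MEMO-es §21.2 (4).**  Assume the family `V` is stable under the pull-backs and
satisfies (Pairs) at every level divisible by `t`.  If `φ ∈ V(L)`, `ψ' ∈ V(L t^j)` and `π_t^* ψ' = π_1^* φ` on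
`Γ₀(L t^{j+1})`, then there is `ψ ∈ V(L)` with `ψ' = π_1^* ψ` and `π_t^* ψ = π_1^* φ` on `Γ₀(L t)` (apply (Pairs)
`j` times, descending one power of `t` each time).  Levels are free variables pinned by two-sided divisibility.
[folklore] -/
theorem exists_descent_of_pairs
    (hStab : ∀ (M L d : ℕ) [NeZero d] (h : M * d ∣ L) (φ : Gamma0 M → Fin 1 → R), φ ∈ V M →
      degeneracyPullback 0 M L d R h φ ∈ V L)
    (hPairs : ∀ (M L L₂ : ℕ) (h₁ : M * 1 ∣ L) (ht : M * t ∣ L) (h₁' : L * 1 ∣ L₂) (ht' : L * t ∣ L₂),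
      0 < M → L ∣ M * t → L₂ ∣ L * t → ∀ φ₁ ∈ V L, ∀ φ₂ ∈ V L,
      degeneracyPullback 0 L L₂ t R ht' φ₁ = degeneracyPullback 0 L L₂ 1 R h₁' φ₂ →
      ∃ ψ ∈ V M, φ₁ = degeneracyPullback 0 M L 1 R h₁ ψ ∧ φ₂ = degeneracyPullback 0 M L t R ht ψ) :
    ∀ (j : ℕ) (L Lj Lj₁ : ℕ) (hj : L * t ^ j ∣ Lj) (hj₁ : Lj * t ∣ Lj₁) (hL₁ : L * 1 ∣ Lj₁), 0 < L →
      Lj ∣ L * t ^ j → Lj₁ ∣ Lj * t → ∀ φ ∈ V L, ∀ ψ' ∈ V Lj,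
      degeneracyPullback 0 Lj Lj₁ t R hj₁ ψ' = degeneracyPullback 0 L Lj₁ 1 R hL₁ φ →
      ∃ ψ ∈ V L, (∀ h : L * 1 ∣ Lj, ψ' = degeneracyPullback 0 L Lj 1 R h ψ) ∧
        ∀ (L₁ : ℕ) (ha : L * t ∣ L₁) (hb : L * 1 ∣ L₁), L₁ ∣ L * t →
          degeneracyPullback 0 L L₁ t R ha ψ = degeneracyPullback 0 L L₁ 1 R hb φ := by
  intro j
  induction j with
  | zero =>
    intro L Lj Lj₁ hj hj₁ hL₁ hL hLj hLj₁ φ hφ ψ' hψ' hpair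
    -- `Lj = L`
    obtain rfl : Lj = L := Nat.dvd_antisymm (by simpa using hLj) (by simpa using hj)
    refine ⟨ψ', hψ', fun h ↦ (degeneracyPullback_one_self h ψ').symm, ?_⟩
    intro L₁ ha hb hL₁'
    -- `L₁ = Lj₁`
    obtain rfl : L₁ = Lj₁ := Nat.dvd_antisymm (hL₁'.trans hj₁) (hLj₁.trans ha)
    exact hpair
  | succ j ih =>
    intro L Lj Lj₁ hj hj₁ hL₁ hL hLj hLj₁ φ hφ ψ' hψ' hpair
    -- the intermediate level `L t^j` and its divisibilities
    have hpow : L * t ^ j * t = L * t ^ (j + 1) := by ring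
    have hm₁ : L * t ^ j * 1 ∣ Lj := by rw [mul_one]; exact (Dvd.intro t hpow).trans hj
    have hmt : L * t ^ j * t ∣ Lj := by rw [hpow]; exact hj
    have hLjm : Lj ∣ L * t ^ j * t := by rw [hpow]; exact hLj
    have hLLj : L * 1 ∣ Lj := by rw [mul_one]; exact (Dvd.intro _ rfl).trans hj
    have h₁' : Lj * 1 ∣ Lj₁ := by rw [mul_one]; exact (Dvd.intro _ rfl).trans hj₁
    have hpos : 0 < L * t ^ j := Nat.mul_pos hL (pow_pos (Nat.pos_of_ne_zero (NeZero.ne t)) j)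
    -- the pair `(ψ', π_1^* φ)` at level `Lj` descends to `ψ₁ ∈ V(L t^j)`
    have hφLj : degeneracyPullback 0 L Lj 1 R hLLj φ ∈ V Lj := hStab L Lj 1 hLLj φ hφ
    have hpair' : degeneracyPullback 0 Lj Lj₁ t R hj₁ ψ' =
        degeneracyPullback 0 Lj Lj₁ 1 R h₁' (degeneracyPullback 0 L Lj 1 R hLLj φ) := by
      rw [degeneracyPullback_one_one h₁' hLLj hL₁]; exact hpair
    obtain ⟨ψ₁, hψ₁, hψ'eq, hφeq⟩ :=
      hPairs (L * t ^ j) Lj Lj₁ hm₁ hmt h₁' hj₁ hpos hLjm hLj₁ ψ' hψ' _ hφLj hpair'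
    -- induction: `ψ₁` descends to `ψ ∈ V(L)`
    obtain ⟨ψ, hψ, hψ₁eq, hfin⟩ :=
      ih L (L * t ^ j) Lj (dvd_refl _) hmt hLLj hL (dvd_refl _) hLjm φ hφ ψ₁ hψ₁ hφeq.symm
    refine ⟨ψ, hψ, fun h ↦ ?_, hfin⟩
    rw [hψ'eq, hψ₁eq (by rw [mul_one]; exact Dvd.intro _ rfl), degeneracyPullback_one_one]

/-- **§21.2 (4): the shift-from-pairs recursion** (`Z_n(L) = 0` from (Pairs) and (Bottom)).  Let `V L ⊆ (Γ₀(L) → R)` be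
a family of degree-`0` cochains stable under the degeneracy pull-backs (e.g. the cocycles lying in the generalised
eigenspace `[𝔪^∞]` of a Hecke eigensystem away from the primes of all levels in play).  Assume
(Pairs) for `L = M t` with `M ≥ 1`: every `φ₁, φ₂ ∈ V(L)` with `π_t^* φ₁ = π_1^* φ₂` on `Γ₀(L t)` are `π_1^* ψ`, `π_t^* ψ`
for some `ψ ∈ V(M)` — E-es-25, pairs form, at a level divisible by `t`; and (Bottom) for `t ∤ L₀`, `L₀ ≥ 1`: every such
pair has `φ₂ = 0` — the classical diagonal Ihara statement.  THEN for all `n ≥ 1`, `L ≥ 1` and `φ ∈ V(L)`: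
`π_{t^n}^* φ = π_1^* φ` on `Γ₀(L t^n)` forces `φ = 0`.  (Strong induction on `L`: the chain
`exists_descent_of_pairs` brings `φ ∈ Z_n(L)` to a pair `(ψ, φ)` at level `L`; if `t ∤ L` (Bottom) ends it, if
`L = M t` (Pairs) gives `A ∈ V(M)` with `φ = π_t^* A` and `A ∈ Z_n(M)`, `M < L`.)  The target levels `L'` are free
variables pinned by two-sided divisibility. [folklore] -/
theorem eq_zero_of_shiftInvariant_of_pairs_of_bottom (ht1 : 1 < t)
    (hStab : ∀ (M L d : ℕ) [NeZero d] (h : M * d ∣ L) (φ : Gamma0 M → Fin 1 → R), φ ∈ V M →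
      degeneracyPullback 0 M L d R h φ ∈ V L)
    (hPairs : ∀ (M L L₂ : ℕ) (h₁ : M * 1 ∣ L) (ht : M * t ∣ L) (h₁' : L * 1 ∣ L₂) (ht' : L * t ∣ L₂),
      0 < M → L ∣ M * t → L₂ ∣ L * t → ∀ φ₁ ∈ V L, ∀ φ₂ ∈ V L,
      degeneracyPullback 0 L L₂ t R ht' φ₁ = degeneracyPullback 0 L L₂ 1 R h₁' φ₂ →
      ∃ ψ ∈ V M, φ₁ = degeneracyPullback 0 M L 1 R h₁ ψ ∧ φ₂ = degeneracyPullback 0 M L t R ht ψ)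
    (hBottom : ∀ (L L₂ : ℕ) (h₁' : L * 1 ∣ L₂) (ht' : L * t ∣ L₂), 0 < L → ¬ t ∣ L → L₂ ∣ L * t →
      ∀ φ₁ ∈ V L, ∀ φ₂ ∈ V L,
      degeneracyPullback 0 L L₂ t R ht' φ₁ = degeneracyPullback 0 L L₂ 1 R h₁' φ₂ → φ₂ = 0) :
    ∀ (L : ℕ) (n : ℕ) (L' : ℕ) (h₁ : L * 1 ∣ L') (hn : L * t ^ n ∣ L'), 0 < L → 1 ≤ n → L' ∣ L * t ^ n →
      ∀ φ ∈ V L, degeneracyPullback 0 L L' (t ^ n) R hn φ = degeneracyPullback 0 L L' 1 R h₁ φ → φ = 0 := by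
  intro L
  induction L using Nat.strong_induction_on with
  | _ L ihL =>
  intro n L' h₁ hn hL hn1 hL' φ hφ hZ
  -- pin `L' = L t^n` and write `n = m + 1`
  obtain rfl : L' = L * t ^ n := Nat.dvd_antisymm hL' hn
  obtain ⟨m, rfl⟩ : ∃ m, n = m + 1 := ⟨n - 1, by omega⟩
  -- CHAIN: `ψ' := π_{t^m}^* φ ∈ V(L t^m)` and the pair `(ψ', φ)` at level `L t^m`, then descend to `ψ ∈ V(L)`
  have hpow : L * t ^ m * t = L * t ^ (m + 1) := by ring
  have hm : L * t ^ m ∣ L * t ^ m := dvd_refl _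
  have hmt : L * t ^ m * t ∣ L * t ^ (m + 1) := by rw [hpow]
  have hψ'V : degeneracyPullback 0 L (L * t ^ m) (t ^ m) R hm φ ∈ V (L * t ^ m) := hStab L _ _ hm φ hφ
  have hpair : degeneracyPullback 0 (L * t ^ m) (L * t ^ (m + 1)) t R hmt
      (degeneracyPullback 0 L (L * t ^ m) (t ^ m) R hm φ) =
      degeneracyPullback 0 L (L * t ^ (m + 1)) 1 R h₁ φ := by
    rw [degeneracyPullback_comp (pow_succ t m).symm hmt hm hn]; exact hZ
  obtain ⟨ψ, hψ, hψ'eq, hψpair⟩ := exists_descent_of_pairs V t hStab hPairs m L (L * t ^ m) (L * t ^ (m + 1))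
    hm hmt h₁ hL (dvd_refl _) (by rw [hpow]) φ hφ _ hψ'V hpair
  by_cases htL : t ∣ L
  · -- `L = M t`: (Pairs) gives `A ∈ V(M)` with `φ = π_t^* A`, and `A ∈ Z_{m+1}(M)` with `M < L`
    obtain ⟨M, rfl⟩ := htL
    have hM : 0 < M := Nat.pos_of_mul_pos_left hL
    -- (Pairs) on the pair `(ψ, φ)` at level `t M`
    have hM1 : M * 1 ∣ t * M := by rw [mul_one]; exact Dvd.intro_left t rfl
    have hMt : M * t ∣ t * M := by rw [mul_comm]
    have hL1 : t * M * 1 ∣ t * M * t := by rw [mul_one]; exact Dvd.intro t rfl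
    obtain ⟨A, hA, hψA, hφA⟩ := hPairs M (t * M) (t * M * t) hM1 hMt hL1 (dvd_refl _) hM
      (by rw [mul_comm]) (dvd_refl _) ψ hψ φ hφ (hψpair (t * M * t) (dvd_refl _) hL1 (dvd_refl _))
    -- `A ∈ Z_{m+1}(M)`, read at the level `t M t^m` (= `M t^{m+1}`): from (b) `π_{t^m}^* φ = π_1^* ψ` there
    have e : M * t ^ (m + 1) = t * M * t ^ m := by ring
    have ha : M * t ^ (m + 1) ∣ t * M * t ^ m := by rw [e]
    have hb : M * 1 ∣ t * M * t ^ m := by rw [mul_one, ← e]; exact Dvd.intro _ rfl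
    have hZA : degeneracyPullback 0 M (t * M * t ^ m) (t ^ (m + 1)) R ha A =
        degeneracyPullback 0 M (t * M * t ^ m) 1 R hb A := by
      have h1 := hψ'eq (by rw [mul_one]; exact Dvd.intro _ rfl)
      rw [hφA, hψA, degeneracyPullback_comp (pow_succ' t m).symm hm hMt ha,
        degeneracyPullback_one_one _ hM1 hb] at h1
      exact h1
    have hA0 : A = 0 :=
      ihL M (by nlinarith) (m + 1) (t * M * t ^ m) hb ha hM (by omega) (by rw [← e]) A hA hZA
    rw [hφA, hA0, map_zero]
  · -- `t ∤ L`: (Bottom) on the pair `(ψ, φ)` at level `L`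
    have hLt1 : L * 1 ∣ L * t := by rw [mul_one]; exact Dvd.intro t rfl
    exact hBottom L (L * t) hLt1 (dvd_refl _) hL htL (dvd_refl _) ψ hψ φ hφ
      (hψpair (L * t) (dvd_refl _) hLt1 (dvd_refl _))

end Recursion


/-! ### §21.2 (5), Khare's glue: a quasi-invariant function on an orbit extends a homomorphism to the generated group -/

section Glue

variable {G X F : Type*} [Group G] [MulAction G X] [AddCommGroup F]

/-- **Khare's glue (no amalgam needed).**  Let a group `G` act on a set `X`, `e : X → F` a function to an abelian group,
and `S ⊆ G` a set of elements each of which moves `e` by a constant (`e (g • x) = e x + c_g` for all `x`).  Then every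
element `g` of the subgroup generated by `S` moves `e` by a constant, namely `e (g • x₀) - e x₀` for any base point `x₀`.
(Use: `X = Γ₀(L₀)·∞ ⊆ P¹(ℚ)`, `e(γ∞) = u(γ)` for a homomorphism `u` on `Γ₀(L₀)` vanishing on the stabiliser of `∞`,
`S = Γ₀(L₀) ∪ {diag(t,1)}`: once the symbol of `u` is `diag(t,1)`-invariant, `u` extends to `⟨Γ₀(L₀), diag(t,1)⟩ ⊇
Γ₀(L₀; ℤ[1/t])`, where the congruence subgroup property — tree theorem
`Literature.NumberTheory.Automorphic.SerreSL2Congruence1970_congruenceSubgroupProperty_away_holds` — applies; this is the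
«fixed vector of the generated group» move of Khare 1995 / MEMO-es §21.2 (3),(5).) [folklore] -/
theorem smul_sub_eq_of_mem_closure (e : X → F) (S : Set G)
    (hS : ∀ g ∈ S, ∃ c : F, ∀ x : X, e (g • x) = e x + c) (x₀ : X) :
    ∀ g ∈ Subgroup.closure S, ∀ x : X, e (g • x) - e x = e (g • x₀) - e x₀ := by
  intro g hg
  induction hg using Subgroup.closure_induction with
  | mem g hg =>
    obtain ⟨c, hc⟩ := hS g hg
    intro x
    rw [hc x, hc x₀]; abel
  | one => intro x; simp
  | mul g h _ _ ihg ihh =>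
    intro x
    have e1 : e ((g * h) • x) - e x = (e (g • (h • x)) - e (h • x)) + (e (h • x) - e x) := by
      rw [mul_smul]; abel
    have e2 : e ((g * h) • x₀) - e x₀ = (e (g • (h • x₀)) - e (h • x₀)) + (e (h • x₀) - e x₀) := by
      rw [mul_smul]; abel
    rw [e1, e2, ihg (h • x), ihg (h • x₀), ihh x]
  | inv g _ ih =>
    intro x
    have e1 : e (g⁻¹ • x) - e x = -(e (g • (g⁻¹ • x)) - e (g⁻¹ • x)) := by
      rw [smul_inv_smul]; abel
    have e2 : e (g⁻¹ • x₀) - e x₀ = -(e (g • (g⁻¹ • x₀)) - e (g⁻¹ • x₀)) := by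
      rw [smul_inv_smul]; abel
    rw [e1, e2, ih (g⁻¹ • x), ih (g⁻¹ • x₀)]

/-- **The extension is a homomorphism**: with `ũ g := e (g • x₀) - e x₀`, `ũ (g h) = ũ g + ũ h` on the subgroup
generated by `S`; and `ũ` restricts to any `u` with `e (γ • x) = e x + u γ` (take `x = x₀`). [folklore] -/
theorem smul_sub_mul_of_mem_closure (e : X → F) (S : Set G)
    (hS : ∀ g ∈ S, ∃ c : F, ∀ x : X, e (g • x) = e x + c) (x₀ : X) {g h : G}
    (hg : g ∈ Subgroup.closure S) :
    e ((g * h) • x₀) - e x₀ = (e (g • x₀) - e x₀) + (e (h • x₀) - e x₀) := by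
  have := smul_sub_eq_of_mem_closure e S hS x₀ g hg (h • x₀)
  rw [mul_smul, ← this]; abel

/-- Bundled form: the extension `ũ : ⟨S⟩ →* Multiplicative F` exists and is pinned by `e`. [folklore] -/
theorem exists_monoidHom_of_quasiInvariant (e : X → F) (S : Set G)
    (hS : ∀ g ∈ S, ∃ c : F, ∀ x : X, e (g • x) = e x + c) (x₀ : X) :
    ∃ ũ : Subgroup.closure S →* Multiplicative F,
      ∀ (g : Subgroup.closure S) (x : X), e ((g : G) • x) = e x + (ũ g).toAdd := by
  let ũ : Subgroup.closure S →* Multiplicative F :=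
    { toFun := fun g ↦ Multiplicative.ofAdd (e ((g : G) • x₀) - e x₀)
      map_one' := by simp
      map_mul' := fun g h ↦ by
        rw [← ofAdd_add, Subgroup.coe_mul, smul_sub_mul_of_mem_closure e S hS x₀ g.2] }
  refine ⟨ũ, fun g x ↦ ?_⟩
  have := smul_sub_eq_of_mem_closure e S hS x₀ g g.2 x
  show e ((g : G) • x) = e x + (e ((g : G) • x₀) - e x₀)
  rw [← this]; abel

end Glue

end Summit.BirchSwinnertonDyer.BirchSwinnertonDyer.Theorems.ManinLocalTwoThree
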